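import Summits.QuantumFields.BalabanUV.T4Continuum.Spine.NE1p.DressedSmallFieldNestedToriTowerLive

/-!
# T⁴ programme, spine estimate NE1′ (node O3b/H2) — THE RATE FAMILY ON THE TOWER: S44's NESTED-TORI END FIRES ON W75's DATUM AT EVERY
# OUTER RATE `r₁ ∈ [0, 1]` — ONE firing parametrised by `r₁`, interpolating W59∕W67's letters (`r₁ = 0`) and W75's (`r₁ = ½`) and reaching
# `r₁ = 1`, where the uncovered-cube letter DIES; at `R = RN` NO letter `v ≥ 0` admits a rate beyond `1`; closed bound `K₀(64,8)·e^{−6r₁}`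

Cell `pub-balaban`, sub-cell `t4`, BINDER-OWNERS row NE1′; crew `b2b-balaban-t4-ne1p-formalise-*`, row **W94 ∕ DAG N29zzzzzf** of `t4/formal/NE1p/LEAVES.md`
(INTENT + STAGED `HOME/CLAIMS.log` l.24283; BOOKED typer RULING R-T150 l.24340 — definition lane, no slot, cap 399), unit
`b2b-balaban-t4-ne1p-formalise-leaf-10` (gen 12).  A FOLLOWER ON A LANDED WITNESS DATUM — imports W75 PART 3
`Spine/NE1p/DressedSmallFieldNestedToriTowerLive` ONLY (p241416; → W75 P1∕P2: the tower, `CR`, `termsT`, `coveredT`∕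
`uncoveredT`, `F3`, `Cctr`, `hadm_T`, `vT`∕`RkpT`∕`A₁T`, `mN_Cctr`, `card_F3`, `card_rodT`; W72 P2's `exp_locE_of_support_single`; S44's END; W59.1's
letters) and re-enters W75's namespace; toy DATA `def`s (the one-parameter letters `vF`∕`RkpF`∕`A₁F`, the majorant `majF`, weights `cF`, cores `GF`,
activity `actF`) + theorems + one closing `example`; 0 `def … : Prop`, 0 cite, 0 sorry; S44's END applied EXACTLY ONCE (`towerEnd_fires_family`,
now with `r₁` a VARIABLE); nothing of S44 ∕ W59 ∕ W67 ∕ W72 ∕ W75 restated.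

WHY.  W59∕W67 fired S44's END at `r₁ = 0` and W75 at `r₁ = ½`, each with its own letter set; W75 P1 LOCATED that at W59's letters `hrate ∧ hRR`
force `r₁ ≤ 0`.  THIS FILE types the whole picture AT THE LETTERS OF RECORD (`R = RN`, W59.1's `ε`∕`R₀`∕`r` — re-choosing `R` moves the interval):
* §1 THE ONE-PARAMETER LETTERS `v(r₁) := (1 − r₁)·vN`, `Rkp(r₁) := 2κ + 2 + r₁`, `A₁(r₁) := A·e^{−5r₁}∕4` meet `hrate`∕`hRR` WITH EQUALITY and
  `hsmall` at value `½` for EVERY `r₁` (`hrate_F`, `hRR_F`, `hsmall_F`); `letters_zero` = W59∕W67's set, `letters_half` = W75's set (`vT`, `RkpT`,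
  `A₁T` — by `rfl`-level arithmetic), `letters_one`: `v(1) = 0` — the uncovered label's letter DIES; **`rate_le_one_of_letters`** (LOCATED): for
  ANY `v ≥ 0`, `hrate ∧ hRR` at `R = RN` force `r₁ ≤ 1` — so the admissible outer rates at `R = RN` are EXACTLY `[0, 1]`, all attained here
  (beyond `1` one must raise `R`, paying `e^{−5ΔR}` in `h229`'s `ε` and raising `R₀` in `hrate2` — re-choosable too, not typed);
* §2 the majorant∕weights∕cores∕activity at `v(r₁)` with the slope's `e^{−5r₁}` carried by the Cauchy weights; `hAmp_F`;
* §3 **`towerEnd_fires_family (h0 : 0 ≤ r₁) (h1 : r₁ ≤ 1)`** — S44's END ONCE, `hadm := hadm_T` BY NAME (W75's index is unchanged), conclusion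
  factor `exp (−(r₁ · torusTreeLen C_R))`; **`towerEnd_fires_family_closed : … ≤ K₀(64,8)·e^{−6r₁}`** (`r₁ = 0`: W67's `K₀`; `½`: W75's `K₀e^{−3}`;
  `1`: `K₀e^{−6}`, cf. W72's `2K₀e^{−6}` at N0o's one-torus face at rate 1); `family_closed_strictAnti`;
* §4 LIVENESS AT EVERY RATE `r₁ ∈ [0, 1]` (`towerEnd_family_live`) — at `r₁ = 1` the uncovered label is weightless but the covered `ε³` survives;
  closing `example` at L = 5: the bounds at `r₁ = 0, ½, 1` ∧ liveness at `r₁ = 1`.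

HONEST FRAMING.  A DECIDED TOY — W75's datum with ONE-PARAMETER RE-CHOSEN letters ([folklore]∕[arith]); every numeral OURS in S44's literal
currency (`64·log 162`, `K₀(64,8)`, `e^{−5R}∕64`); `hinner` CHOSEN (W59's `mN`); (B1b) NOT claimed; (B3-amp) MET by CHOSEN weights — UNPRINTED for
Bałaban's cores (G-ne9p2-5); «every outer rate is admissible» is a statement about the SHAPE's bookkeeping on a toy — the price is exponentially
smaller letters, NOTHING is said about slack on Bałaban's densities; print's ½L, (L+2)⁴, «L odd > 11», (1.28), (2.27), (2.35)–(2.41) TYPE∕CONTEXT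
only; WHICH tori are Bałaban's = pv22's READING (D-pv22.3); 0 binders instantiated on Bałaban's densities; no wall item; wall v1.8 (T4-DAG
v48∕v49∕v51) — words, not kind — does NOT move; R-t4r2-Q2 NOT met; NE1′ ⇐ the named binders — NOT proved, NOT printed; spine PROVED 0∕9; count
9 unchanged; ABSOLUTE RULE honoured.  Rung (B)+1 on ONE finite four-torus — NOT infinite volume, NOT a mass gap, NOT OS on ℝ⁴, NOT Clay.  HONEST
DEPENDENCY: continuum YM on T⁴ ⇐ BetaPertH ∧ nine spine estimates (0/9 proved); BetaPertH ⇐ (D1) ∧ (D4) ∧ CAP+tail; G-an2-4 gates asym, D1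
and NE2/3/4.
-/

noncomputable section

namespace Summit.QuantumFields.BalabanUV.T4Continuum.NE1p.DressedSmallFieldNestedToriTower

open Set Metric MeasureTheory Complex
open scoped BigOperators
open Literature.MathematicalPhysics.QuantumFieldTheory.Balaban1983to89
open Literature.MathematicalPhysics.QuantumFieldTheory.Balaban1983to89.B12TreeDecay (K₀ K₀_pos)
open Literature.MathematicalPhysics.QuantumFieldTheory.Balaban1983to89.B13Resummation (locE)
open Literature.MathematicalPhysics.QuantumFieldTheory.Balaban1983to89.TreeLengthTorus (TPt TDom tsys torusTreeLen)
open Literature.MathematicalPhysics.QuantumFieldTheory.Balaban1983to89.TreeLengthTorusGeometry (tgeometry TTouch ttouch_symm)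
open Summit.QuantumFields.BalabanUV.T4Continuum.B13HistMeasurable (B13HistM)
open Summit.QuantumFields.BalabanUV.T4Continuum.B13HistWitness (toyFrame)
open Summit.QuantumFields.BalabanUV.T4Continuum.B13TermParamGaussianBi (BiCore)
open Summit.QuantumFields.BalabanUV.T4Continuum.NE1p.DressedSmallFieldTorusWitness (dressedConst_le_one)
open Summit.QuantumFields.BalabanUV.T4Continuum.NE1p.DressedSmallFieldCoresWitness (E1 crd liveTable norm_liveTable_le coreW N₁_coreW
  ctr0 hroom0 Acst Acst_pos incr integral_incr_pos)
open Summit.QuantumFields.BalabanUV.T4Continuum.NE1p.DressedSmallFieldCoresMassWitness (letterMass_coreW cM cM_pos)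
open Summit.QuantumFields.BalabanUV.T4Continuum.NE1p.DressedSmallFieldDepCoresWitness (budget_half termAt_coreW_pencil
  closedForm_real_sub_zero norm_term_le)
open Summit.QuantumFields.BalabanUV.T4Continuum.NE1p.DressedSmallFieldInnerLink (link_torus')
open Summit.QuantumFields.BalabanUV.T4Continuum.NE1p.DressedSmallFieldNestedTori
  (attachedPart_locE_le_of_coresAt_pencil_components_nestedTori)
open Summit.QuantumFields.BalabanUV.T4Continuum.NE1p.DressedSmallFieldNestedToriWitness (rN RN vN R₀N εN εN_pos vN_pos hκ_N_eq
  hRR_N_eq hrate2_N_eq hκR_N h229_N_eq mN mN_nonneg hinner_N_eq LabelN εN_le_one vN_le)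
open Summit.QuantumFields.BalabanUV.T4Continuum.NE1p.DressedSmallFieldNestedToriRod (CR CR_val torusTreeLen_CR)
open Summit.QuantumFields.BalabanUV.T4Continuum.NE1p.DressedSmallFieldRodRateWitness (exp_locE_of_support_single)

/-! ## §1 THE ONE-PARAMETER LETTERS: for every outer rate `r₁` the uncovered-cube letter, the step rate and the slope that meet S44's clauses
WITH EQUALITY at `R = RN`; the endpoints `r₁ = 0` (W59∕W67's letters), `r₁ = ½` (W75's), `r₁ = 1` (the uncovered letter DIES); no rate beyond `1` -/

section Letters
variable (r₁ : ℝ)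

/-- THE UNCOVERED-CUBE LETTER AT OUTER RATE `r₁` (toy DATA): `v(r₁) := (1 − r₁)·vN = (1 − r₁)·e^{−5R}∕64`. [folklore] -/
def vF : ℝ := (1 - r₁) * vN

/-- THE STEP RATE AT OUTER RATE `r₁` (toy DATA): `Rkp(r₁) := 2κ + 2 + r₁`. [folklore] -/
def RkpF : ℝ := 2 * (64 * Real.log 162) + 2 + r₁

/-- THE SLOPE AT OUTER RATE `r₁` (toy DATA): `A₁(r₁) := A·e^{−5r₁}∕4`. [folklore] -/
def A₁F : ℝ := Acst * Real.exp (-(5 * r₁)) / 4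

/-- `0 ≤ v(r₁)` for `r₁ ≤ 1`. [arith] -/
theorem vF_nonneg (h1 : r₁ ≤ 1) : 0 ≤ vF r₁ := by unfold vF; exact mul_nonneg (by linarith) vN_pos.le

/-- `v(r₁) ≤ vN ≤ 1∕64` for `0 ≤ r₁`. [arith] -/
theorem vF_le (h0 : 0 ≤ r₁) : vF r₁ ≤ 1 / 64 := by
  unfold vF; have := vN_pos; nlinarith [vN_le]

/-- `0 < A₁(r₁)`. [arith] -/
theorem A₁F_pos : 0 < A₁F r₁ := by unfold A₁F; have := Acst_pos; positivity

/-- `64·v(r₁)·e^{5R} = 1 − r₁` (W59.1's `64·vN·e^{5RN} = 1`). [arith] -/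
theorem sixtyfour_vF_exp : 64 * (vF r₁ * Real.exp (RN * 5)) = 1 - r₁ := by
  have h : 64 * (vN * Real.exp (RN * 5)) = 1 := by have := hRR_N_eq; unfold RN at this ⊢; linarith
  unfold vF
  calc 64 * ((1 - r₁) * vN * Real.exp (RN * 5)) = (1 - r₁) * (64 * (vN * Real.exp (RN * 5))) := by ring
    _ = 1 - r₁ := by rw [h, mul_one]

/-- **S44's `hrate` AT OUTER RATE `r₁`** (with equality). [arith] -/
theorem hrate_F : r₁ + 2 * (64 * Real.log 162) + 2 ≤ RkpF r₁ := by unfold RkpF; linarith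

/-- **S44's `hRR` AT `(RN, v(r₁))`** (with equality: `Rkp(r₁) = RN − (1 − r₁)`). [arith] -/
theorem hRR_F : RkpF r₁ ≤ RN - 64 * (vF r₁ * Real.exp (RN * 5)) := by rw [sixtyfour_vF_exp]; unfold RkpF RN; linarith

/-- **S44's «ε small» CLAUSE AT OUTER RATE `r₁`**: `(0 + 2·A₁(r₁))·e^{5r₁+1}·K₀(64,8)·9·64 = ½ ≤ 1`. [arith] -/
theorem hsmall_F : (0 + 2 * A₁F r₁) * Real.exp (5 * r₁ + 1) * K₀ 64 8 * 9 * 64 ≤ 1 := by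
  have hK := K₀_pos (64 : ℝ) 8
  have he := Real.exp_pos 1
  have hsplit : Real.exp (5 * r₁ + 1) = Real.exp (5 * r₁) * Real.exp 1 := Real.exp_add _ _
  have h1 : Real.exp (-(5 * r₁)) * Real.exp (5 * r₁) = 1 := by rw [← Real.exp_add]; norm_num
  unfold A₁F Acst
  rw [hsplit]
  calc (0 + 2 * ((Real.exp 1 * K₀ 64 8 * 9 * 64)⁻¹ * Real.exp (-(5 * r₁)) / 4)) * (Real.exp (5 * r₁) * Real.exp 1) *
        K₀ 64 8 * 9 * 64
      = 1 / 2 * (Real.exp (-(5 * r₁)) * Real.exp (5 * r₁)) *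
          ((Real.exp 1 * K₀ 64 8 * 9 * 64)⁻¹ * (Real.exp 1 * K₀ 64 8 * 9 * 64)) := by ring
    _ = 1 / 2 := by rw [h1, inv_mul_cancel₀ (by positivity)]; norm_num
    _ ≤ 1 := by norm_num

/-- **THE ENDPOINT `r₁ = 0` IS W59∕W67's LETTER SET**: `v(0) = vN`, `Rkp(0) = 2κ + 2`, `A₁(0) = A∕4`. [arith] -/
theorem letters_zero : vF 0 = vN ∧ RkpF 0 = 2 * (64 * Real.log 162) + 2 ∧ A₁F 0 = Acst / 4 := by
  unfold vF RkpF A₁F; refine ⟨by ring, by ring, ?_⟩; rw [mul_zero, neg_zero, Real.exp_zero, mul_one]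

/-- **THE MIDPOINT `r₁ = ½` IS W75's LETTER SET**: `v(½) = vT`, `Rkp(½) = RkpT`, `A₁(½) = A₁T`. [arith] -/
theorem letters_half : vF (1 / 2) = vT ∧ RkpF (1 / 2) = RkpT ∧ A₁F (1 / 2) = A₁T := by
  unfold vF vT RkpF RkpT A₁F A₁T; refine ⟨by ring, by ring, ?_⟩; norm_num

/-- **THE ENDPOINT `r₁ = 1`: THE UNCOVERED-CUBE LETTER DIES** (`v(1) = 0`) — the whole unit of `hRR`'s room is spent on the outer rate. [arith] -/
theorem letters_one : vF 1 = 0 ∧ RkpF 1 = RN := by unfold vF RkpF RN; exact ⟨by ring, by ring⟩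

/-- **NO OUTER RATE BEYOND `1` AT `R = RN`** (LOCATED): for ANY letter `v ≥ 0`, S44's `hrate` ∧ `hRR` force `r₁ ≤ 1 − 64·v·e^{5R} ≤ 1`;
the family above ATTAINS every `r₁ ∈ [0, 1]`.  (Beyond `1` one must raise `R` itself — then `h229` shrinks `ε` by `e^{−5ΔR}` and `hrate2` raises
`R₀`: re-choosable too, at exponential cost; not typed here.) [arith] -/
theorem rate_le_one_of_letters {r₁ Rkp v : ℝ} (hv : 0 ≤ v) (hrate : r₁ + 2 * (64 * Real.log 162) + 2 ≤ Rkp)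
    (hRR : Rkp ≤ RN - 64 * (v * Real.exp (RN * 5))) : r₁ ≤ 1 := by
  have h : 0 ≤ 64 * (v * Real.exp (RN * 5)) := by positivity
  have hRN : RN = 2 * (64 * Real.log 162) + 3 := rfl
  linarith

end Letters

/-! ## §2 THE FAMILY's MAJORANTS, CORES, ACTIVITY and `hAmp` on W75's tower datum -/

section Datum
variable (L M : ℕ) [NeZero L] [NeZero M] (r₁ : ℝ)

/-- S44's majorant of a label AT THE LETTER `v(r₁)` (toy DATA). [folklore] -/
def majF (l : LabelN L (L * M)) : ℝ := vF r₁ ^ l.1.card * ∏ x ∈ l.2.1.attach, (εN L * mN L (L * M) (l.2.2 x.1 x.2).1 (l.2.2 x.1 x.2).2)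

/-- `0 ≤ maj` (`r₁ ≤ 1`). [arith] -/
theorem majF_nonneg (h1 : r₁ ≤ 1) (l : LabelN L (L * M)) : 0 ≤ majF L M r₁ l :=
  mul_nonneg (pow_nonneg (vF_nonneg r₁ h1) _) (Finset.prod_nonneg fun _ _ => mul_nonneg (εN_pos L).le (mN_nonneg L (L * M) _ _))

/-- The covered label weighs `ε³` at every rate (W75's `majT_coveredT` computation). [arith] -/
theorem majF_coveredT (hL : 5 ≤ L) : majF L M r₁ (coveredT L M) = εN L ^ 3 := by
  unfold majF coveredT
  rw [Finset.card_empty, pow_zero, one_mul,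
    Finset.prod_attach (F3 L M) (fun Z => εN L * mN L (L * M) (Cctr L M Z.2.1.choose) ())]
  simp only [mN_Cctr, mul_one]
  rw [Finset.prod_const, card_F3 L M hL]

/-- The uncovered label weighs `v(r₁)³`. [arith] -/
theorem majF_uncoveredT (hL : 5 ≤ L) : majF L M r₁ (uncoveredT L M) = vF r₁ ^ 3 := by
  unfold majF uncoveredT
  rw [Finset.attach_empty, Finset.prod_empty, mul_one, CR_val, card_rodT L M hL]

variable (r : ℝ) (hr : 0 ≤ r)

/-- THE CAUCHY WEIGHT AT OUTER RATE `r₁` (toy DATA): `c l := (cM r∕2)·e^{−5r₁}·maj l`. [folklore] -/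
def cF (l : LabelN L (L * M)) : ℝ := cM r / 2 * Real.exp (-(5 * r₁)) * majF L M r₁ l

/-- THE CORE FAMILY AT OUTER RATE `r₁` (toy DATA). [folklore] -/
def GF : ∀ (_ : ℕ) (_ : LabelN L (L * M)), ℕ → BiCore toyFrame (fun _ : Unit => (0 : ℕ)) ℂ Unit E1 :=
  fun _ l _ => coreW (cF L M r₁ r l) r hr

/-- The core at `(k, l, X)`. [folklore] -/
@[simp] theorem GF_apply (k : ℕ) (l : LabelN L (L * M)) (X : ℕ) : GF L M r₁ r hr k l X = coreW (cF L M r₁ r l) r hr := rfl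

/-- THE ACTIVITY AT OUTER RATE `r₁` (toy DATA): over W75's index `termsT` (the rod polymer only). [folklore] -/
def actF (k : ℕ) (s : ℂ) (Z : (tsys 4 (L * M)).Dom) : ℂ :=
  ∑ l ∈ termsT L M Z, (GF L M r₁ r hr k l k).termAt (0 : ℂ) ((0 : B13HistM toyFrame) + s • liveTable)

/-- **`hAmp` AT OUTER RATE `r₁`** [decided toy], S44's LITERAL shape at `(A₀, A₁, ϱ) = (0, A₁(r₁), 2)`. [folklore] -/
theorem hAmp_F (h1 : r₁ ≤ 1) (k : ℕ) :
    ∀ Z : (tsys 4 (L * M)).Dom, Z.1 ⊆ (CR L M).1 → ∀ l ∈ termsT L M Z,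
      (GF L M r₁ r hr k l k).lam.real univ *
          ((GF L M r₁ r hr k l k).wB * (fun (_ : ℕ) (_ : LabelN L (L * M)) (_ : ℕ) => (1 : ℝ)) k l k *
            Real.exp ((fun (_ : ℕ) (_ : LabelN L (L * M)) (_ : ℕ) => (0 : ℝ)) k l k)) *
          (Real.pi / ((fun (_ : ℕ) (_ : LabelN L (L * M)) (_ : ℕ) => (1 : ℝ)) k l k / 2)) ^ (Module.finrank ℝ E1 / 2 : ℝ) *
        Real.exp ((GF L M r₁ r hr k l k).N₁ * (‖(0 : B13HistM toyFrame)‖ + 2 * ‖liveTable‖)) ≤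
      (0 + 2 * A₁F r₁) * (vF r₁ ^ l.1.card * ∏ x ∈ l.2.1.attach, (εN L * mN L (L * M) (l.2.2 x.1 x.2).1 (l.2.2 x.1 x.2).2)) := by
  intro Z _ l _
  simp only [GF_apply]
  rw [letterMass_coreW, N₁_coreW, norm_zero, zero_add]
  have hp : 0 ≤ majF L M r₁ l := majF_nonneg L M r₁ h1 l
  have hT : 2 * ‖liveTable‖ ≤ 2 := by linarith [norm_liveTable_le]
  have hb := budget_half r hr hT
  have he : 0 ≤ Real.exp (-(5 * r₁)) := (Real.exp_pos _).le
  show |cF L M r₁ r l| * Real.sqrt (2 * Real.pi) * Real.exp (r * (2 * ‖liveTable‖)) ≤ (0 + 2 * A₁F r₁) * majF L M r₁ l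
  unfold cF A₁F
  rw [abs_mul, abs_of_nonneg hp, abs_mul, abs_of_nonneg he]
  calc |cM r / 2| * Real.exp (-(5 * r₁)) * majF L M r₁ l * Real.sqrt (2 * Real.pi) * Real.exp (r * (2 * ‖liveTable‖))
      = majF L M r₁ l * Real.exp (-(5 * r₁)) * (|cM r / 2| * Real.sqrt (2 * Real.pi) * Real.exp (r * (2 * ‖liveTable‖))) := by
        ring
    _ ≤ majF L M r₁ l * Real.exp (-(5 * r₁)) * (Acst / 2) := mul_le_mul_of_nonneg_left hb (mul_nonneg hp he)
    _ = (0 + 2 * (Acst * Real.exp (-(5 * r₁)) / 4)) * majF L M r₁ l := by ring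

/-! ## §3 THE END FIRES AT EVERY OUTER RATE `r₁ ∈ [0, 1]`; closed form `K₀(64,8)·e^{−6r₁}` -/

open Classical in
/-- **S44's END FIRES ON THE TOWER AT EVERY OUTER RATE `0 ≤ r₁ ≤ 1`** [decided toy]: W75's datum and binders throughout, EXCEPT the letter
triple `(v, Rkp, A₁) := (v(r₁), Rkp(r₁), A₁(r₁))` and the cores `GF`; conclusion with the factor `exp (−(r₁ · torusTreeLen C_R))`. [folklore] -/
theorem towerEnd_fires_family (hL : 5 ≤ L) (h0 : 0 ≤ r₁) (h1 : r₁ ≤ 1) (k : ℕ) :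
    ‖locE (TTouch (d := 4) (N := L * M)) (fun Z : (tsys 4 (L * M)).Dom => Z.1) (actF L M r₁ r hr k 1) (CR L M).1 -
        locE (TTouch (d := 4) (N := L * M)) (fun Z : (tsys 4 (L * M)).Dom => Z.1) (actF L M r₁ r hr k 0) (CR L M).1‖ ≤
      4 * (Real.exp 1 * 9 * 64 * K₀ 64 8 ^ 2) * A₁F r₁ * Real.exp (-(r₁ * torusTreeLen (CR L M).1)) :=
  have h3 : 3 ≤ L := by omega
  attachedPart_locE_le_of_coresAt_pencil_components_nestedTori h3 (GF L M r₁ r hr)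
    (Win := Set.univ) (ctr := ctr0) (ROp := fun _ => 1) (RHist := fun _ => 2) (R' := fun _ => 2)
    (mq := fun _ _ _ => 1) (bq := fun _ _ _ => 0) (N₀ := fun _ _ _ => 1)
    hroom0 (fun _ _ _ _ _ _ _ => one_pos)
    (fun _ _ _ _ _ _ _ => ⟨fun _ _ => aestronglyMeasurable_const, fun _ => differentiableOn_const _, fun _ _ _ => by
      show ‖(1 : ℂ)‖ ≤ 1; rw [norm_one]⟩)
    (fun _ _ _ _ _ _ _ => ⟨fun _ _ => (Complex.measurable_ofReal.comp (measurable_snd.norm.pow_const 2)).aestronglyMeasurable,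
      fun _ _ => differentiableOn_const _, fun _ _ _ v => by
        show 1 * ‖v‖ ^ 2 - 0 ≤ (((‖v‖ ^ 2 : ℝ) : ℂ)).re; rw [Complex.ofReal_re]; simp⟩)
    (g := fun _ => 0) (Set.mem_univ _) (U := ()) (o := 0) (h₀ := 0) (w := liveTable) (ϱ := 2)
    (by show ‖(0 : ℂ) - 0‖ ≤ 1; simp)
    (by show ‖(0 : B13HistM toyFrame) - 0‖ + 2 * ‖liveTable‖ ≤ 2; rw [sub_zero, norm_zero, zero_add];
        linarith [norm_liveTable_le])
    (emb := fun _ => k) (fun _ => rfl) (terms := termsT L M) (act := actF L M r₁ r hr k) (fun _ _ _ => rfl)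
    (A₀ := 0) (A₁ := A₁F r₁) (r₁ := r₁) (CR L M)
    le_rfl (A₁F_pos r₁).le h0 (hrate_F r₁) (hsmall_F r₁)
    (fun _ => (Finset.univ : Finset Unit)) (mN L (L * M)) (mN_nonneg L (L * M)) (fun Z' => Z'.2.1.choose)
    (fun Z' => Z'.2.1.choose_spec)
    (ε := εN L) (c₀ := 0) (R₀ := R₀N L) (r := rN) (R := RN) (c' := 5) (v := vF r₁)
    (εN_pos L).le (vF_nonneg r₁ h1) (fun Z₀ => (hinner_N_eq L (L * M) Z₀).le) (hκR_N L h3) (hrate2_N_eq L h3).le hκ_N_eq.le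
    (h229_N_eq L).le (link_torus' 4 (L * M)) (hRR_F r₁) (hadm_T L M hL) (hAmp_F L M r₁ r hr h1 k) le_rfl
    (by have := A₁F_pos r₁; linarith)

open Classical in
/-- **… IN CLOSED FORM: `≤ K₀(64,8)·e^{−6r₁}`** — the slope's prepaid `e^{−5r₁}` TIMES the collected `e^{−r₁·1}`; `r₁ = 0`: W67's `K₀`;
`r₁ = ½`: W75's `K₀e^{−3}`; `r₁ = 1`: `K₀e^{−6}` (cf. W72's `2K₀e^{−6}` at N0o's one-torus face, rate 1). [folklore] -/
theorem towerEnd_fires_family_closed (hL : 5 ≤ L) (h0 : 0 ≤ r₁) (h1 : r₁ ≤ 1) (k : ℕ) :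
    ‖locE (TTouch (d := 4) (N := L * M)) (fun Z : (tsys 4 (L * M)).Dom => Z.1) (actF L M r₁ r hr k 1) (CR L M).1 -
        locE (TTouch (d := 4) (N := L * M)) (fun Z : (tsys 4 (L * M)).Dom => Z.1) (actF L M r₁ r hr k 0) (CR L M).1‖ ≤
      K₀ 64 8 * Real.exp (-(6 * r₁)) := by
  refine (towerEnd_fires_family L M r₁ r hr hL h0 h1 k).trans (le_of_eq ?_)
  rw [torusTreeLen_CR L M hL, mul_one]
  unfold A₁F Acst
  have hK := K₀_pos (64 : ℝ) 8
  have he := Real.exp_pos 1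
  have h6 : Real.exp (-(5 * r₁)) * Real.exp (-r₁) = Real.exp (-(6 * r₁)) := by rw [← Real.exp_add]; ring_nf
  rw [← h6]
  field_simp

/-- The closed bound is STRICTLY DECREASING in the rate: more outer rate, smaller number — paid for by exponentially smaller letters. [arith] -/
theorem family_closed_strictAnti {a b : ℝ} (hab : a < b) : K₀ 64 8 * Real.exp (-(6 * b)) < K₀ 64 8 * Real.exp (-(6 * a)) :=
  mul_lt_mul_of_pos_left (Real.exp_lt_exp.2 (by linarith)) (K₀_pos 64 8)

/-! ## §4 LIVENESS AT EVERY RATE OF THE FAMILY (even at `r₁ = 1`, where the uncovered label is dead: the covered `ε³` survives) -/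

/-- Off the rod the activity vanishes. [folklore] -/
theorem actF_of_ne {Z : (tsys 4 (L * M)).Dom} (h : Z ≠ CR L M) (k : ℕ) (s : ℂ) : actF L M r₁ r hr k s Z = 0 := by
  unfold actF; rw [termsT_of_ne L M h, Finset.sum_empty]

open Classical in
/-- The majorant mass at the rod: `ε³ + v(r₁)³`. [arith] -/
theorem majF_sum_CR (hL : 5 ≤ L) : ∑ l ∈ termsT L M (CR L M), majF L M r₁ l = εN L ^ 3 + vF r₁ ^ 3 := by
  rw [termsT_CR, Finset.sum_insert (by rw [Finset.mem_singleton]; exact coveredT_ne_uncoveredT L M), Finset.sum_singleton,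
    majF_coveredT L M r₁ hL, majF_uncoveredT L M r₁ hL]

/-- `0 < ε³ + v(r₁)³` for `r₁ ≤ 1` — the covered label is live at EVERY rate. [arith] -/
theorem massF_pos (h1 : r₁ ≤ 1) : 0 < εN L ^ 3 + vF r₁ ^ 3 := by
  have := pow_pos (εN_pos L) 3; have := pow_nonneg (vF_nonneg r₁ h1) 3; linarith

/-- `e^{−5r₁}·(ε³ + v(r₁)³) ≤ 1 + 1∕64` for `0 ≤ r₁ ≤ 1`. [arith] -/
theorem scaledMassF_le (h0 : 0 ≤ r₁) (h1 : r₁ ≤ 1) : Real.exp (-(5 * r₁)) * (εN L ^ 3 + vF r₁ ^ 3) ≤ 1 + 1 / 64 := by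
  have hε3 : εN L ^ 3 ≤ 1 := pow_le_one₀ (εN_pos L).le (εN_le_one L)
  have hv0 := vF_nonneg r₁ h1
  have hv1 : vF r₁ ≤ 1 := by linarith [vF_le r₁ h0]
  have hv3 : vF r₁ ^ 3 ≤ vF r₁ := by
    calc vF r₁ ^ 3 = vF r₁ * (vF r₁ * vF r₁) := by ring
      _ ≤ vF r₁ * (1 * 1) := by gcongr
      _ = vF r₁ := by ring
  have he : Real.exp (-(5 * r₁)) ≤ 1 := Real.exp_le_one_iff.2 (by linarith)
  calc Real.exp (-(5 * r₁)) * (εN L ^ 3 + vF r₁ ^ 3) ≤ 1 * (εN L ^ 3 + vF r₁ ^ 3) :=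
        mul_le_mul_of_nonneg_right he (massF_pos L r₁ h1).le
    _ ≤ 1 + 1 / 64 := by linarith [vF_le r₁ h0]

open Classical in
/-- The activity at the rod in closed form (ONE common integral). [folklore] -/
theorem actF_CR (hL : 5 ≤ L) (k : ℕ) (s : ℂ) :
    actF L M r₁ r hr k s (CR L M) = ((cM r / 2 * Real.exp (-(5 * r₁)) * (εN L ^ 3 + vF r₁ ^ 3) : ℝ) : ℂ) *
      ∫ v : E1, cexp (s * ((r : ℂ) * (Real.exp (-(crd v ^ 2)) : ℂ))) * cexp (-(((‖v‖ ^ 2 : ℝ) : ℂ))) := by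
  unfold actF
  simp only [GF_apply, termAt_coreW_pencil]
  rw [← Finset.sum_mul, ← majF_sum_CR L M r₁ hL, Finset.mul_sum]
  push_cast
  unfold cF
  push_cast
  rfl

/-- **THE ATTACHED PART IS NOT ZERO AT EVERY RATE `r₁ ≤ 1`** (`0 < r`). [folklore] -/
theorem actF_live (hL : 5 ≤ L) (h1 : r₁ ≤ 1) (hr0 : 0 < r) (k : ℕ) :
    actF L M r₁ r hr k 1 (CR L M) ≠ actF L M r₁ r hr k 0 (CR L M) := by
  intro h
  have h0 := sub_eq_zero.2 h
  rw [show (1 : ℂ) = ((1 : ℝ) : ℂ) from Complex.ofReal_one.symm, actF_CR L M r₁ r hr hL, actF_CR L M r₁ r hr hL,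
    closedForm_real_sub_zero _ r hr 1, one_mul] at h0
  have hc : 0 < cM r / 2 * Real.exp (-(5 * r₁)) * (εN L ^ 3 + vF r₁ ^ 3) :=
    mul_pos (mul_pos (half_pos (cM_pos r)) (Real.exp_pos _)) (massF_pos L r₁ h1)
  rcases mul_eq_zero.1 h0 with hc0 | hI
  · exact hc.ne' (by exact_mod_cast hc0)
  · exact (integral_incr_pos r hr0).ne' (by exact_mod_cast hI)

/-- The activity at the rod lies strictly inside the unit disc for `‖s‖ ≤ 2` (`0 ≤ r₁ ≤ 1`). [folklore] -/
theorem norm_actF_CR_lt_one (hL : 5 ≤ L) (h0 : 0 ≤ r₁) (h1 : r₁ ≤ 1) (k : ℕ) {s : ℂ} (hs : ‖s‖ ≤ 2) :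
    ‖actF L M r₁ r hr k s (CR L M)‖ < 1 := by
  rw [actF_CR L M r₁ r hr hL]
  set μ : ℝ := Real.exp (-(5 * r₁)) * (εN L ^ 3 + vF r₁ ^ 3) with hμ
  have hμ0 : 0 ≤ μ := mul_nonneg (Real.exp_pos _).le (massF_pos L r₁ h1).le
  have hμ1 : μ ≤ 1 + 1 / 64 := scaledMassF_le L r₁ h0 h1
  have hπ : 0 < Real.sqrt Real.pi := Real.sqrt_pos.2 Real.pi_pos
  have hlt : Real.sqrt Real.pi < Real.sqrt (2 * Real.pi) := Real.sqrt_lt_sqrt Real.pi_pos.le (by linarith [Real.pi_pos])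
  have hq : Real.sqrt Real.pi / Real.sqrt (2 * Real.pi) < 1 := (div_lt_one (hπ.trans hlt)).2 hlt
  have hq0 : 0 ≤ Real.sqrt Real.pi / Real.sqrt (2 * Real.pi) := by positivity
  have hA : Acst ≤ 1 := dressedConst_le_one
  have hb := norm_term_le r hr hs
  have hn : ‖((cM r / 2 * Real.exp (-(5 * r₁)) * (εN L ^ 3 + vF r₁ ^ 3) : ℝ) : ℂ) *
        ∫ v : E1, cexp (s * ((r : ℂ) * (Real.exp (-(crd v ^ 2)) : ℂ))) * cexp (-(((‖v‖ ^ 2 : ℝ) : ℂ)))‖ =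
      μ * ‖((cM r / 2 : ℝ) : ℂ) * ∫ v : E1, cexp (s * ((r : ℂ) * (Real.exp (-(crd v ^ 2)) : ℂ))) * cexp (-(((‖v‖ ^ 2 : ℝ) : ℂ)))‖ := by
    rw [norm_mul, norm_mul, Complex.norm_real, Complex.norm_real, Real.norm_eq_abs, Real.norm_eq_abs,
      show cM r / 2 * Real.exp (-(5 * r₁)) * (εN L ^ 3 + vF r₁ ^ 3) = cM r / 2 * μ by rw [hμ]; ring, abs_mul, abs_of_nonneg hμ0]
    ring
  rw [hn]
  calc μ * ‖((cM r / 2 : ℝ) : ℂ) * ∫ v : E1, cexp (s * ((r : ℂ) * (Real.exp (-(crd v ^ 2)) : ℂ))) * cexp (-(((‖v‖ ^ 2 : ℝ) : ℂ)))‖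
      ≤ (1 + 1 / 64) * (Acst / 2 * (Real.sqrt Real.pi / Real.sqrt (2 * Real.pi))) := mul_le_mul hμ1 hb (norm_nonneg _) (by norm_num)
    _ < 1 := by
        have := Acst_pos
        nlinarith

open Classical in
/-- **THE END's QUANTITY IS NOT ZERO AT EVERY RATE `0 ≤ r₁ ≤ 1`** [decided toy] (W72 P2's `exp_locE_of_support_single` BY NAME, as in W75 P3). -/
theorem towerEnd_family_live (hL : 5 ≤ L) (h0 : 0 ≤ r₁) (h1 : r₁ ≤ 1) (hr0 : 0 < r) (k : ℕ) :
    locE (TTouch (d := 4) (N := L * M)) (fun Z : (tsys 4 (L * M)).Dom => Z.1) (actF L M r₁ r hr k 1) (CR L M).1 ≠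
      locE (TTouch (d := 4) (N := L * M)) (fun Z : (tsys 4 (L * M)).Dom => Z.1) (actF L M r₁ r hr k 0) (CR L M).1 := by
  intro h
  have hE : ∀ {s : ℂ}, ‖s‖ ≤ 2 →
      cexp (locE (TTouch (d := 4) (N := L * M)) (fun Z : (tsys 4 (L * M)).Dom => Z.1) (actF L M r₁ r hr k s) (CR L M).1) =
        1 + actF L M r₁ r hr k s (CR L M) := fun hs =>
    exp_locE_of_support_single (TTouch (d := 4) (N := L * M)) (fun _ _ h => ttouch_symm _ _ h)
      (fun Z : (tsys 4 (L * M)).Dom => Z.1) (actF L M r₁ r hr k _) rfl (fun _ _ hZ => actF_of_ne L M r₁ r hr hZ k _)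
      (norm_actF_CR_lt_one L M r₁ r hr hL h0 h1 k hs)
  have h' := congrArg cexp h
  rw [hE (by simp), hE (by simp), add_right_inj] at h'
  exact actF_live L M r₁ r hr hL h1 hr0 k h'

open Classical in
/-- **THE WHOLE ADMISSIBLE INTERVAL, DECIDED**: at `L = 5` the END fires, live, at the rates `0`, `½`, `1` with the closed bounds `K₀`, `K₀e^{−3}`,
`K₀e^{−6}` — and NO letter `v ≥ 0` admits a rate beyond `1` at `R = RN` (`rate_le_one_of_letters`). [folklore] -/
example (hr0 : 0 < r) (k : ℕ) :
    (‖locE (TTouch (d := 4) (N := 5 * M)) (fun Z : (tsys 4 (5 * M)).Dom => Z.1) (actF 5 M 0 r hr k 1) (CR 5 M).1 -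
          locE (TTouch (d := 4) (N := 5 * M)) (fun Z : (tsys 4 (5 * M)).Dom => Z.1) (actF 5 M 0 r hr k 0) (CR 5 M).1‖ ≤
        K₀ 64 8 * Real.exp (-(6 * 0)) ∧
      ‖locE (TTouch (d := 4) (N := 5 * M)) (fun Z : (tsys 4 (5 * M)).Dom => Z.1) (actF 5 M (1 / 2) r hr k 1) (CR 5 M).1 -
          locE (TTouch (d := 4) (N := 5 * M)) (fun Z : (tsys 4 (5 * M)).Dom => Z.1) (actF 5 M (1 / 2) r hr k 0) (CR 5 M).1‖ ≤
        K₀ 64 8 * Real.exp (-(6 * (1 / 2))) ∧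
      ‖locE (TTouch (d := 4) (N := 5 * M)) (fun Z : (tsys 4 (5 * M)).Dom => Z.1) (actF 5 M 1 r hr k 1) (CR 5 M).1 -
          locE (TTouch (d := 4) (N := 5 * M)) (fun Z : (tsys 4 (5 * M)).Dom => Z.1) (actF 5 M 1 r hr k 0) (CR 5 M).1‖ ≤
        K₀ 64 8 * Real.exp (-(6 * 1))) ∧
    locE (TTouch (d := 4) (N := 5 * M)) (fun Z : (tsys 4 (5 * M)).Dom => Z.1) (actF 5 M 1 r hr k 1) (CR 5 M).1 ≠
      locE (TTouch (d := 4) (N := 5 * M)) (fun Z : (tsys 4 (5 * M)).Dom => Z.1) (actF 5 M 1 r hr k 0) (CR 5 M).1 :=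
  ⟨⟨towerEnd_fires_family_closed 5 M 0 r hr (by norm_num) le_rfl zero_le_one k,
    towerEnd_fires_family_closed 5 M (1 / 2) r hr (by norm_num) (by norm_num) (by norm_num) k,
    towerEnd_fires_family_closed 5 M 1 r hr (by norm_num) zero_le_one le_rfl k⟩,
   towerEnd_family_live 5 M 1 r hr (by norm_num) zero_le_one le_rfl hr0 k⟩

end Datum

end Summit.QuantumFields.BalabanUV.T4Continuum.NE1p.DressedSmallFieldNestedToriTower

end
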